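import Summits.CriticalPhenomena.PercolationContinuityZ3.Theorems.PercNearOneGluingNoHeavyQuantFarSunSupportSteps
import HarnessLib

/-!
# FAR beyond trees: the SUPPORT LEMMA — every reached-set-level two-copy certificate for `HairyCycle.SunFAR K j` vanishes
# outside the windows of length `K − j`

builds on p205010 (kernel theorem, internal audit signed; external expert review pending)

Support file (`--supports stmt-CriticalPhenomena-4575`), seat `prim-cert-1` (gen 30); memo `prim-cert-1/FROM-prim-cert-1-g30-SUPPORT-LEMMA.md`
(gen 28 found the rule empirically: `FROM-prim-cert-1-g28-TOP-LAYERS.md` §2b–2d).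
Setting of `TK.sunFAR_of_layerCert` (`…QuantFarSunCertLayer`): a certificate is `a_k(R') ≥ 0`, `b(R') ≥ 0` on subsets of `range K` satisfying
the CORE INEQUALITY for `TK.Wgen K j a b` (nested prefix pair `m ≤ l ≤ K+1`, suffix pair `u ≤ v ≤ K`, sure hairs `Z`, split hairs `T`).
Put `L = K − j` and call `ω_s = [s, s+L)` (`s ≤ j`) an L-WINDOW.  **Theorem `TK.support_lemma`: if `2j+1 ≤ K`, then for every certificate, every
window `ω` and every `Y ⊆ range K` that does not split `ω` (`ω ⊆ Y` or `ω ∩ Y = ∅`): `b(Y) = 0` and `a_k(Y) = 0` for every `k < K` outside `ω`.**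
(A ghost outcome leaving some window unsplit never uses `b` and bets only inside that window.  Taking all windows inside a run: if `Y` or its
complement contains a run `ρ` of `≥ L` consecutive positions then `b(Y) = 0` and `a_k(Y) = 0` off the positions common to all L-windows of `ρ` —
gen 28's "support rule", which is exactly the set of classes vanishing at the analytic centre at `(3,1),(4,1),(5,2),(6,2),(7,2),(7,3)`.)
Proof: induction on `n(Y) = |ωᶜ ∖ Y|`, each step reading one instance of the core inequality in which, by the induction hypothesis, every
term except the target has sign `≤ 0`: coverages `(range K, range K)` with `Z = Y`, `T = Yᶜ` (kills `b` of the sets `⊇ ω`); coverages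
`(range K, ωᶜ) = (cov s 0, cov s (s+L))` with `Z = ω ∪ S`, `T = ωᶜ ∖ S` (kills `b(S)` for `S ⊆ ωᶜ` and the `a_k`, `k ∉ ω`, of `ω ∪ S`) and with
`Z = S` (kills the `a_k(S)`, `k ∉ ω`).  Elementary [this work]; no sorries, standard axioms.
* `TK.support_induction` — the induction on `n(Y) = |ωᶜ ∖ Y|` (steps `TK.support_level0/stepI/stepII/stepIII` in `…QuantFarSunSupportSteps`,
  bookkeeping `TK.Fgen_large`, `TK.W_full_large`, … in `…QuantFarSunSupportWindow`);
* `TK.support_lemma` — the theorem; `TK.support_lemma_b`, `TK.support_lemma_a` — the two conclusions separately.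
-/



namespace Summit.CriticalPhenomena.PercolationContinuityZ3.Theorems.HairyCycle

namespace TK

open Finset

variable {K j : ℕ} {a : ℕ → Finset ℕ → ℤ} {b : Finset ℕ → ℤ}

section Steps

variable {ω Q : Finset ℕ} {s L : ℕ}
  (ha : ∀ k, ∀ R', R' ⊆ range K → 0 ≤ a k R') (hb : ∀ R', R' ⊆ range K → 0 ≤ b R')
  (hcore : ∀ l m u v : ℕ, m ≤ l → l ≤ K + 1 → u ≤ v → v ≤ K →
    ∀ Z T : Finset ℕ, Z ⊆ range K → T ⊆ range K → Disjoint Z T →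
      0 ≤ (∑ J ∈ T.powerset, Wgen K j a b (cov K l u ∩ (Z ∪ J)) (cov K m v ∩ (Z ∪ (T \ J)))) +
        ∑ J ∈ T.powerset, Wgen K j a b (cov K l v ∩ (Z ∪ J)) (cov K m u ∩ (Z ∪ (T \ J))))
  (hK2j : (0 : ℤ) < (K : ℤ) - 2 * j) (hsL : s + L ≤ K) (hcovQ : cov K s (s + L) = Q)
  (hωK : ω ⊆ range K) (hQ : ∀ k, k ∈ Q ↔ k < K ∧ k ∉ ω) (hjω : j < ω.card) (hQcard : Q.card = j)

include ha hb hcore hK2j hsL hcovQ hωK hQ hjω hQcard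

/-- THE INDUCTION: every `Y ⊆ range K` not splitting `ω` has `b(Y) = 0` and `a_k(Y) = 0` on `Q`. [this work] -/
theorem support_induction (n : ℕ) : ∀ Y : Finset ℕ, Y ⊆ range K → (ω ⊆ Y ∨ Disjoint ω Y) → (Q \ Y).card = n →
    b Y = 0 ∧ ∀ k ∈ Q, a k Y = 0 := by
  induction n using Nat.strong_induction_on with
  | _ n IH =>
    intro Y hYK hspl hn
    obtain ⟨hb_full, hb_Q, ha_full, ha_Q⟩ := support_level0 ha hb hcore hK2j hsL hcovQ hωK hQ hjω hQcard
    have hQK : Q ⊆ range K := fun k hk => mem_range.2 ((hQ k).1 hk).1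
    rcases Nat.eq_zero_or_pos n with hn0 | hnpos
    · -- level 0: `Y = range K` or `Y = Q`
      subst hn0
      have hQY : Q ⊆ Y := by
        have := Finset.card_eq_zero.1 hn; rwa [sdiff_eq_empty_iff_subset] at this
      rcases hspl with hωY | hdis
      · have hYe : Y = range K := by
          apply Subset.antisymm hYK
          intro k hk
          by_cases hkω : k ∈ ω
          · exact hωY hkω
          · exact hQY ((hQ k).2 ⟨mem_range.1 hk, hkω⟩)
        rw [hYe]; exact ⟨hb_full, ha_full⟩
      · have hYQ : Y ⊆ Q := fun k hk => (hQ k).2 ⟨mem_range.1 (hYK hk), fun hkω => disjoint_left.1 hdis hkω hk⟩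
        have hYe : Y = Q := Subset.antisymm hYQ hQY
        rw [hYe]; exact ⟨hb_Q, ha_Q⟩
    · have IH' : ∀ Y' : Finset ℕ, Y' ⊆ range K → (ω ⊆ Y' ∨ Disjoint ω Y') → (Q \ Y').card < n →
          b Y' = 0 ∧ ∀ k ∈ Q, a k Y' = 0 := fun Y' h1 h2 h3 => IH _ h3 Y' h1 h2 rfl
      rcases hspl with hωY | hdis
      · refine ⟨support_stepI ha hb hcore hK2j hsL hcovQ hωK hQ hjω hQcard hnpos IH' hYK hωY hn, ?_⟩
        have hSQ : Y \ ω ⊆ Q := fun k hk => by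
          rw [mem_sdiff] at hk; exact (hQ k).2 ⟨mem_range.1 (hYK hk.1), hk.2⟩
        have hXe : ω ∪ (Y \ ω) = Y := union_sdiff_of_subset hωY
        have hlev : (Q \ (Y \ ω)).card = n := by
          have : Q \ (Y \ ω) = Q \ Y := by
            ext k; simp only [mem_sdiff]
            constructor
            · rintro ⟨hkQ, hk⟩; exact ⟨hkQ, fun hkY => hk ⟨hkY, ((hQ k).1 hkQ).2⟩⟩
            · rintro ⟨hkQ, hkY⟩; exact ⟨hkQ, fun hk => hkY hk.1⟩
          rw [this, hn]
        have h2 := (support_stepII ha hb hcore hK2j hsL hcovQ hωK hQ hjω hQcard hnpos IH' hSQ hlev).2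
        rwa [hXe] at h2
      · have hYQ : Y ⊆ Q := fun k hk => (hQ k).2 ⟨mem_range.1 (hYK hk), fun hkω => disjoint_left.1 hdis hkω hk⟩
        have hbY := (support_stepII ha hb hcore hK2j hsL hcovQ hωK hQ hjω hQcard hnpos IH' hYQ hn).1
        exact ⟨hbY, support_stepIII ha hb hcore hK2j hsL hcovQ hωK hQ hjω hQcard hnpos IH' hYQ hn hbY⟩

end Steps

/-! ### The support lemma -/

/-- **Support lemma.**  Let `2j+1 ≤ K` and let `(a, b) ≥ 0` satisfy the core inequality of `TK.sunFAR_of_layerCert`.  For every window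
`ω = [s, s + (K−j))` (`s ≤ j`) and every `Y ⊆ range K` with `ω ⊆ Y` or `ω ∩ Y = ∅`: `b(Y) = 0`, and `a_k(Y) = 0` for every `k < K` outside `ω`.
[this work] -/
theorem support_lemma (hK : 2 * j + 1 ≤ K)
    (ha : ∀ k, ∀ R', R' ⊆ range K → 0 ≤ a k R') (hb : ∀ R', R' ⊆ range K → 0 ≤ b R')
    (hcore : ∀ l m u v : ℕ, m ≤ l → l ≤ K + 1 → u ≤ v → v ≤ K →
      ∀ Z T : Finset ℕ, Z ⊆ range K → T ⊆ range K → Disjoint Z T →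
        0 ≤ (∑ J ∈ T.powerset, Wgen K j a b (cov K l u ∩ (Z ∪ J)) (cov K m v ∩ (Z ∪ (T \ J)))) +
          ∑ J ∈ T.powerset, Wgen K j a b (cov K l v ∩ (Z ∪ J)) (cov K m u ∩ (Z ∪ (T \ J))))
    {s : ℕ} (hs : s ≤ j) {Y : Finset ℕ} (hY : Y ⊆ range K)
    (hsplit : Ico s (s + (K - j)) ⊆ Y ∨ Disjoint (Ico s (s + (K - j))) Y) :
    b Y = 0 ∧ ∀ k, k < K → k ∉ Ico s (s + (K - j)) → a k Y = 0 := by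
  have hsL : s + (K - j) ≤ K := by omega
  have hK2j : (0 : ℤ) < (K : ℤ) - 2 * j := by
    have h' : ((2 * j + 1 : ℕ) : ℤ) ≤ (K : ℤ) := by exact_mod_cast hK
    push_cast at h'; linarith
  have hωK : Ico s (s + (K - j)) ⊆ range K := by
    intro k hk; rw [mem_Ico] at hk; rw [mem_range]; omega
  have hQ : ∀ k, k ∈ range K \ Ico s (s + (K - j)) ↔ k < K ∧ k ∉ Ico s (s + (K - j)) := fun k => by
    rw [mem_sdiff, mem_range]
  have hjω : j < (Ico s (s + (K - j))).card := by rw [Nat.card_Ico]; omega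
  have hQcard : (range K \ Ico s (s + (K - j))).card = j := by
    rw [card_sdiff_of_subset hωK, card_range, Nat.card_Ico]; omega
  have res := support_induction ha hb hcore hK2j hsL (cov_window s (K - j)) hωK hQ hjω hQcard _ Y hY hsplit rfl
  exact ⟨res.1, fun k hk hkω => res.2 k ((hQ k).2 ⟨hk, hkω⟩)⟩

/-- The `b`-part of the support lemma: a ghost outcome that leaves some window unsplit never uses `b`. [this work] -/
theorem support_lemma_b (hK : 2 * j + 1 ≤ K)
    (ha : ∀ k, ∀ R', R' ⊆ range K → 0 ≤ a k R') (hb : ∀ R', R' ⊆ range K → 0 ≤ b R')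
    (hcore : ∀ l m u v : ℕ, m ≤ l → l ≤ K + 1 → u ≤ v → v ≤ K →
      ∀ Z T : Finset ℕ, Z ⊆ range K → T ⊆ range K → Disjoint Z T →
        0 ≤ (∑ J ∈ T.powerset, Wgen K j a b (cov K l u ∩ (Z ∪ J)) (cov K m v ∩ (Z ∪ (T \ J)))) +
          ∑ J ∈ T.powerset, Wgen K j a b (cov K l v ∩ (Z ∪ J)) (cov K m u ∩ (Z ∪ (T \ J))))
    {s : ℕ} (hs : s ≤ j) {Y : Finset ℕ} (hY : Y ⊆ range K)
    (hsplit : Ico s (s + (K - j)) ⊆ Y ∨ Disjoint (Ico s (s + (K - j))) Y) : b Y = 0 :=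
  (support_lemma hK ha hb hcore hs hY hsplit).1

/-- The `a`-part of the support lemma: a ghost outcome that leaves the window `[s, s+K−j)` unsplit bets only inside it. [this work] -/
theorem support_lemma_a (hK : 2 * j + 1 ≤ K)
    (ha : ∀ k, ∀ R', R' ⊆ range K → 0 ≤ a k R') (hb : ∀ R', R' ⊆ range K → 0 ≤ b R')
    (hcore : ∀ l m u v : ℕ, m ≤ l → l ≤ K + 1 → u ≤ v → v ≤ K →
      ∀ Z T : Finset ℕ, Z ⊆ range K → T ⊆ range K → Disjoint Z T →
        0 ≤ (∑ J ∈ T.powerset, Wgen K j a b (cov K l u ∩ (Z ∪ J)) (cov K m v ∩ (Z ∪ (T \ J)))) +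
          ∑ J ∈ T.powerset, Wgen K j a b (cov K l v ∩ (Z ∪ J)) (cov K m u ∩ (Z ∪ (T \ J))))
    {s : ℕ} (hs : s ≤ j) {Y : Finset ℕ} (hY : Y ⊆ range K)
    (hsplit : Ico s (s + (K - j)) ⊆ Y ∨ Disjoint (Ico s (s + (K - j))) Y) {k : ℕ} (hk : k < K)
    (hkω : k ∉ Ico s (s + (K - j))) : a k Y = 0 :=
  (support_lemma hK ha hb hcore hs hY hsplit).2 k hk hkω

end TK

end Summit.CriticalPhenomena.PercolationContinuityZ3.Theorems.HairyCycle
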